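import Summits.ValiantsHypothesis.ValiantsHypothesis.Theorems.KPlusLogSqLawTropicalBToeplitzBlockSwap

/-!
# Route `KPlusLogSqLaw`, crux `TropicalB` — Toeplitz sector: windows of unique optima and the frame recursion of Conjecture T

HONEST FRAMING.  Helper toward the registered stubs `stub_tropThin` / `stub_tropFat` of
`Cruxes/TropicalB/Lines/birth.lean` (crux `Summit.ValiantsHypothesis.ValiantsHypothesis.Theses.KPlusLogSqLaw.TropicalB`,
ledger item `stmt-ValiantsHypothesis-19771`, route `KPlusLogSqLaw`; cell `pub-symmetroid`, seat `val-sym-trop-p3`,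
2026-08-26).  Structure of the cell's Conjecture T (linear Toeplitz instances, hypothesis of
`toeplitz_chain_le_of_linearBound`): the FRAME RECURSION located in the extremal chains (kernel certificates
`…ToeplitzSeven/Eight/Nine`: every optimum there sits in a frame regime).  Nothing here bounds `Φ`, `TropicalB`,
`KPlusLogSqLaw`, `MatrixDescartes` or anything about `VP ≠ VNP`.

THE RESULTS.
* `toeplitz_opt_window` — WINDOWS OF UNIQUE OPTIMA ARE UNIQUE OPTIMA: if the unique maximiser `τ` (among admissible
  permutations of `Fin m`) leaves the window `[a, a + ℓ)` invariant, its window pattern is a permutation `τw` of `Fin ℓ`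
  (`τw j + a = τ (a + j)`) which is the unique maximiser of the SAME instance `(ψ, α)` at the same slope among admissible
  permutations of `Fin ℓ` — Toeplitz costs are translation-invariant, and any better or tying window pattern could be
  IMPLANTED into `τ` (explicit permutation with explicit inverse; the complement of an invariant window is invariant,
  `perm_compl_window`, `perm_symm_window`).
* `toeplitz_window_chain_le` — hence along a chain the members that leave a window invariant and AGREE OUTSIDE it (a fixed
  frame) are at most any chain bound `Φ` of the same instance at the window's size.
* `toeplitz_transpositionFrame_chain_le` — the instance every extremal chain exhibits: members containing the transposition
  `(0, m−1)` are at most `Φ(m−2)`-many (window `[1, m−1)`).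
READING.  Conjecture T thus has the recursive shape `Φ(m) ≤ Σ_frames Φ(window)` + (members with no invariant window); the
open part is the number of FRAMES a chain can use and the frameless members (block-swap rigidity, `…ToeplitzBlockSwap`,
constrains the latter).

References: folklore (restriction of an optimal assignment to an invariant block is optimal for the sub-instance);
`perm_not_mem_of_mapsTo` (`…TropicalBToeplitzBlockSwap`).
-/

set_option linter.dupNamespace false
set_option autoImplicit false

namespace Summit.ValiantsHypothesis.ValiantsHypothesis.Theorems.KPlusLogSqLaw

open scoped BigOperators
open Finset

section Window

variable {m : ℕ}

/-- If a permutation leaves the window `[a, a + ℓ)` invariant, so does its inverse. [folklore] -/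
theorem perm_symm_window (τ : Equiv.Perm (Fin m)) (a ℓ : ℕ)
    (hinv : ∀ b : Fin m, a ≤ (b : ℕ) → (b : ℕ) < a + ℓ → a ≤ ((τ b : Fin m) : ℕ) ∧ ((τ b : Fin m) : ℕ) < a + ℓ)
    (y : Fin m) (hy1 : a ≤ (y : ℕ)) (hy2 : (y : ℕ) < a + ℓ) :
    a ≤ ((τ.symm y : Fin m) : ℕ) ∧ ((τ.symm y : Fin m) : ℕ) < a + ℓ := by
  by_contra h
  have key := perm_not_mem_of_mapsTo τ (univ.filter fun x : Fin m => a ≤ (x : ℕ) ∧ (x : ℕ) < a + ℓ)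
    (fun x hx => by
      simp only [mem_filter, mem_univ, true_and] at hx ⊢
      exact hinv x hx.1 hx.2)
    (τ.symm y) (by simp only [mem_filter, mem_univ, true_and]; exact h)
  rw [Equiv.apply_symm_apply] at key
  simp only [mem_filter, mem_univ, true_and] at key
  exact key ⟨hy1, hy2⟩

/-- A permutation leaving the window `[a, a + ℓ)` invariant maps its complement to the complement. [folklore] -/
theorem perm_compl_window (τ : Equiv.Perm (Fin m)) (a ℓ : ℕ)
    (hinv : ∀ b : Fin m, a ≤ (b : ℕ) → (b : ℕ) < a + ℓ → a ≤ ((τ b : Fin m) : ℕ) ∧ ((τ b : Fin m) : ℕ) < a + ℓ)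
    (x : Fin m) (hx : ¬ (a ≤ (x : ℕ) ∧ (x : ℕ) < a + ℓ)) :
    ¬ (a ≤ ((τ x : Fin m) : ℕ) ∧ ((τ x : Fin m) : ℕ) < a + ℓ) := by
  have key := perm_not_mem_of_mapsTo τ (univ.filter fun x : Fin m => a ≤ (x : ℕ) ∧ (x : ℕ) < a + ℓ)
    (fun x hx => by
      simp only [mem_filter, mem_univ, true_and] at hx ⊢
      exact hinv x hx.1 hx.2)
    x (by simp only [mem_filter, mem_univ, true_and]; exact hx)
  simpa only [mem_filter, mem_univ, true_and] using key

/-- Re-indexing a sum over the window `[a, a + ℓ)` of `Fin m` by `Fin ℓ`. [folklore] -/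
theorem sum_finWindow_eq (a ℓ : ℕ) (h : a + ℓ ≤ m) (F : Fin m → ℤ) :
    ∑ x ∈ univ.filter (fun x : Fin m => a ≤ (x : ℕ) ∧ (x : ℕ) < a + ℓ), F x =
      ∑ j : Fin ℓ, F ⟨a + j, by omega⟩ := by
  let e : Fin ℓ → Fin m := fun j => ⟨a + j, by omega⟩
  have he : Function.Injective e := fun j j' hjj => Fin.ext (by simp [e, Fin.ext_iff] at hjj; omega)
  have himg : univ.image e = univ.filter (fun x : Fin m => a ≤ (x : ℕ) ∧ (x : ℕ) < a + ℓ) := by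
    ext x
    simp only [mem_image, mem_univ, true_and, mem_filter, e]
    constructor
    · rintro ⟨j, rfl⟩; simp
    · intro hx; exact ⟨⟨(x : ℕ) - a, by omega⟩, Fin.ext (by simp; omega)⟩
  rw [← himg, sum_image (fun j _ j' _ h => he h)]

/-- **Windows of unique optima are unique optima (linear Toeplitz instances).**  Let `τ` be the unique maximiser of
`W_θ` among admissible permutations of `Fin m` and let the window `[a, a + ℓ)` be `τ`-invariant.  Then the window pattern of
`τ` is realised by a permutation `τw` of `Fin ℓ` (`τw j + a = τ (a + j)`), and `τw` is the UNIQUE maximiser of the SAME instance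
`(ψ, α)` at the same slope among admissible permutations of `Fin ℓ`: implanting any competitor `σ'` into the window of `τ`
gives an admissible competitor of `τ` with the same weight outside the window (Toeplitz costs are translation-invariant).
This is the recursion behind the FRAME regimes of Conjecture T: e.g. the chain members containing the transposition
`(0, m−1)` carry unique optima of the size-`(m−2)` instance in their middle window. [folklore] -/
theorem toeplitz_opt_window (ψ α : ℤ → ℤ) (P : ℤ → Prop) (θ : ℤ) (τ : Equiv.Perm (Fin m)) (a ℓ : ℕ)
    (h : a + ℓ ≤ m)
    (hinv : ∀ b : Fin m, a ≤ (b : ℕ) → (b : ℕ) < a + ℓ → a ≤ ((τ b : Fin m) : ℕ) ∧ ((τ b : Fin m) : ℕ) < a + ℓ)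
    (hτP : ∀ b, P ((τ b : ℤ) - b))
    (huniq : ∀ σ : Equiv.Perm (Fin m), σ ≠ τ → (∀ b, P ((σ b : ℤ) - b)) →
      ∑ b, (θ * ψ ((σ b : ℤ) - b) + α ((σ b : ℤ) - b)) < ∑ b, (θ * ψ ((τ b : ℤ) - b) + α ((τ b : ℤ) - b))) :
    ∃ τw : Equiv.Perm (Fin ℓ),
      (∀ (j : Fin ℓ) (b : Fin m), (b : ℕ) = a + j → ((τw j : Fin ℓ) : ℕ) + a = ((τ b : Fin m) : ℕ)) ∧
      (∀ j, P ((τw j : ℤ) - j)) ∧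
      ∀ σ' : Equiv.Perm (Fin ℓ), σ' ≠ τw → (∀ j, P ((σ' j : ℤ) - j)) →
        ∑ j, (θ * ψ ((σ' j : ℤ) - j) + α ((σ' j : ℤ) - j)) < ∑ j, (θ * ψ ((τw j : ℤ) - j) + α ((τw j : ℤ) - j)) := by
  have hsymm := perm_symm_window τ a ℓ hinv
  have hcomp := perm_compl_window τ a ℓ hinv
  -- the window permutation
  let f : Fin ℓ → Fin ℓ := fun j => ⟨((τ ⟨a + j, by omega⟩ : Fin m) : ℕ) - a, by
    have := hinv ⟨a + j, by omega⟩ (by simp) (by simp); omega⟩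
  let g : Fin ℓ → Fin ℓ := fun j => ⟨((τ.symm ⟨a + j, by omega⟩ : Fin m) : ℕ) - a, by
    have := hsymm ⟨a + j, by omega⟩ (by simp) (by simp); omega⟩
  have hgf : ∀ j, g (f j) = j := by
    intro j
    have h1 := hinv ⟨a + j, by omega⟩ (by simp) (by simp)
    apply Fin.ext
    simp only [f, g]
    have e1 : (⟨a + (((τ ⟨a + j, by omega⟩ : Fin m) : ℕ) - a), by omega⟩ : Fin m) = τ ⟨a + j, by omega⟩ :=
      Fin.ext (by simp; omega)
    rw [e1, Equiv.symm_apply_apply]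
    simp
  have hfg : ∀ j, f (g j) = j := by
    intro j
    have h1 := hsymm ⟨a + j, by omega⟩ (by simp) (by simp)
    apply Fin.ext
    simp only [f, g]
    have e1 : (⟨a + (((τ.symm ⟨a + j, by omega⟩ : Fin m) : ℕ) - a), by omega⟩ : Fin m) = τ.symm ⟨a + j, by omega⟩ :=
      Fin.ext (by simp; omega)
    rw [e1, Equiv.apply_symm_apply]
    simp
  let τw : Equiv.Perm (Fin ℓ) := ⟨f, g, hgf, hfg⟩
  have hτw : ∀ (j : Fin ℓ) (b : Fin m), (b : ℕ) = a + j → ((τw j : Fin ℓ) : ℕ) + a = ((τ b : Fin m) : ℕ) := by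
    intro j b hb
    have hb' : b = ⟨a + j, by omega⟩ := Fin.ext hb
    have h1 := hinv ⟨a + j, by omega⟩ (by simp) (by simp)
    show ((f j : Fin ℓ) : ℕ) + a = _
    rw [hb']; simp only [f]; omega
  -- displacements inside the window agree
  have hdisp : ∀ j : Fin ℓ, ((τw j : Fin ℓ) : ℤ) - j = ((τ ⟨a + j, by omega⟩ : Fin m) : ℤ) - (a + j : ℕ) := by
    intro j
    have := hτw j ⟨a + j, by omega⟩ rfl
    push_cast
    omega
  refine ⟨τw, hτw, fun j => ?_, fun σ' hne hσ'P => ?_⟩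
  · rw [hdisp]
    have := hτP ⟨a + j, by omega⟩
    push_cast at this ⊢
    exact this
  -- implant `σ'` into the window of `τ`
  let F : Fin m → Fin m := fun x =>
    if hx : a ≤ (x : ℕ) ∧ (x : ℕ) < a + ℓ then ⟨a + σ' ⟨(x : ℕ) - a, by omega⟩, by
      have := (σ' ⟨(x : ℕ) - a, by omega⟩).isLt; omega⟩
    else τ x
  let G : Fin m → Fin m := fun y =>
    if hy : a ≤ (y : ℕ) ∧ (y : ℕ) < a + ℓ then ⟨a + σ'.symm ⟨(y : ℕ) - a, by omega⟩, by
      have := (σ'.symm ⟨(y : ℕ) - a, by omega⟩).isLt; omega⟩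
    else τ.symm y
  have hGF : ∀ x, G (F x) = x := by
    intro x
    by_cases hx : a ≤ (x : ℕ) ∧ (x : ℕ) < a + ℓ
    · have hFx : F x = ⟨a + σ' ⟨(x : ℕ) - a, by omega⟩, by
          have := (σ' ⟨(x : ℕ) - a, by omega⟩).isLt; omega⟩ := dif_pos hx
      rw [hFx]
      simp only [G]
      rw [dif_pos (by simp)]
      apply Fin.ext
      simp only [Nat.add_sub_cancel_left, Fin.eta, Equiv.symm_apply_apply]
      omega
    · have hFx : F x = τ x := dif_neg hx
      rw [hFx]
      simp only [G]
      rw [dif_neg (hcomp x hx), Equiv.symm_apply_apply]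
  have hFG : ∀ y, F (G y) = y := by
    intro y
    by_cases hy : a ≤ (y : ℕ) ∧ (y : ℕ) < a + ℓ
    · have hGy : G y = ⟨a + σ'.symm ⟨(y : ℕ) - a, by omega⟩, by
          have := (σ'.symm ⟨(y : ℕ) - a, by omega⟩).isLt; omega⟩ := dif_pos hy
      rw [hGy]
      simp only [F]
      rw [dif_pos (by simp)]
      apply Fin.ext
      simp only [Nat.add_sub_cancel_left, Fin.eta, Equiv.apply_symm_apply]
      omega
    · have hGy : G y = τ.symm y := dif_neg hy
      rw [hGy]
      simp only [F]
      have : ¬ (a ≤ ((τ.symm y : Fin m) : ℕ) ∧ ((τ.symm y : Fin m) : ℕ) < a + ℓ) := by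
        intro h'
        have := hinv (τ.symm y) h'.1 h'.2
        rw [Equiv.apply_symm_apply] at this
        exact hy this
      rw [dif_neg this, Equiv.apply_symm_apply]
  let σ : Equiv.Perm (Fin m) := ⟨F, G, hGF, hFG⟩
  have hσ_in : ∀ j : Fin ℓ, ((σ ⟨a + j, by omega⟩ : Fin m) : ℤ) - (a + j : ℕ) = ((σ' j : Fin ℓ) : ℤ) - j := by
    intro j
    show ((F ⟨a + j, by omega⟩ : Fin m) : ℤ) - (a + j : ℕ) = _
    simp only [F]
    rw [dif_pos (by simp)]
    simp only [Nat.add_sub_cancel_left, Fin.eta]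
    push_cast
    ring
  have hσ_out : ∀ x : Fin m, ¬ (a ≤ (x : ℕ) ∧ (x : ℕ) < a + ℓ) → σ x = τ x := by
    intro x hx
    show F x = τ x
    exact dif_neg hx
  -- `σ ≠ τ`
  have hστ : σ ≠ τ := by
    intro hEq
    apply hne
    apply Equiv.ext
    intro j
    apply Fin.ext
    have h1 := hσ_in j
    have h2 := hdisp j
    rw [hEq] at h1
    have : ((σ' j : Fin ℓ) : ℤ) = ((τw j : Fin ℓ) : ℤ) := by linarith
    exact_mod_cast this
  -- admissibility of `σ`
  have hσP : ∀ b, P ((σ b : ℤ) - b) := by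
    intro b
    by_cases hb : a ≤ (b : ℕ) ∧ (b : ℕ) < a + ℓ
    · have hb' : b = ⟨a + (((b : ℕ) - a : ℕ) : ℕ), by omega⟩ := Fin.ext (by simp; omega)
      have := hσ_in ⟨(b : ℕ) - a, by omega⟩
      rw [← hb'] at this
      have e : ((b : ℕ) : ℤ) = ((a + ((b : ℕ) - a) : ℕ) : ℤ) := by push_cast; omega
      rw [show ((σ b : Fin m) : ℤ) - (b : ℤ) = ((σ' ⟨(b : ℕ) - a, by omega⟩ : Fin ℓ) : ℤ) - (((b : ℕ) - a : ℕ) : ℕ)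
        by rw [← this, e]]
      exact hσ'P _
    · rw [hσ_out b hb]; exact hτP b
  -- compare weights: split both sums into window + complement
  have hlt := huniq σ hστ hσP
  set w : Fin m → ℤ := fun b => θ * ψ ((σ b : ℤ) - b) + α ((σ b : ℤ) - b) with hw
  set w' : Fin m → ℤ := fun b => θ * ψ ((τ b : ℤ) - b) + α ((τ b : ℤ) - b) with hw'
  have hsplit := sum_filter_add_sum_filter_not univ (fun x : Fin m => a ≤ (x : ℕ) ∧ (x : ℕ) < a + ℓ) w
  have hsplit' := sum_filter_add_sum_filter_not univ (fun x : Fin m => a ≤ (x : ℕ) ∧ (x : ℕ) < a + ℓ) w'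
  have hout : ∑ x ∈ univ.filter (fun x : Fin m => ¬ (a ≤ (x : ℕ) ∧ (x : ℕ) < a + ℓ)), w x =
      ∑ x ∈ univ.filter (fun x : Fin m => ¬ (a ≤ (x : ℕ) ∧ (x : ℕ) < a + ℓ)), w' x := by
    refine sum_congr rfl fun x hx => ?_
    simp only [mem_filter, mem_univ, true_and] at hx
    simp only [hw, hw', hσ_out x hx]
  have hin : ∑ x ∈ univ.filter (fun x : Fin m => a ≤ (x : ℕ) ∧ (x : ℕ) < a + ℓ), w x =
      ∑ j : Fin ℓ, (θ * ψ ((σ' j : ℤ) - j) + α ((σ' j : ℤ) - j)) := by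
    rw [sum_finWindow_eq a ℓ h w]
    refine sum_congr rfl fun j _ => ?_
    simp only [hw]
    rw [← hσ_in j]
  have hin' : ∑ x ∈ univ.filter (fun x : Fin m => a ≤ (x : ℕ) ∧ (x : ℕ) < a + ℓ), w' x =
      ∑ j : Fin ℓ, (θ * ψ ((τw j : ℤ) - j) + α ((τw j : ℤ) - j)) := by
    rw [sum_finWindow_eq a ℓ h w']
    refine sum_congr rfl fun j _ => ?_
    simp only [hw']
    rw [hdisp j]
  have e1 : ∑ b, w b = ∑ b, (θ * ψ ((σ b : ℤ) - b) + α ((σ b : ℤ) - b)) := rfl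
  have e2 : ∑ b, w' b = ∑ b, (θ * ψ ((τ b : ℤ) - b) + α ((τ b : ℤ) - b)) := rfl
  rw [← e1, ← e2, ← hsplit, ← hsplit', hout, hin, hin'] at hlt
  linarith

/-- **Framed chain members are bounded by the window's own chain bound.**  Along a family `τ` of pairwise distinct
admissible unique maximisers at strictly increasing slopes `θ'`, let `S` be a set of indices whose permutations leave the
window `[a, a + ℓ)` invariant and AGREE outside it (a fixed frame).  Then `S.card ≤ Φ` for every `Φ` bounding the chains
of the same instance at size `ℓ` (hypothesis `hΦ`, the shape of `toeplitz_chain_le_of_linearBound`'s hypothesis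
specialised to `(ψ, α, P)`): the windows are pairwise distinct unique optima of the size-`ℓ` instance at the same slopes
(`toeplitz_opt_window`).  With the frame `0 ↦ m − 1 ↦ 0` this reads «chain members containing the transposition
`(0, m−1)` are at most `Φ(m − 2)`». [folklore] -/
theorem toeplitz_window_chain_le (ψ α : ℤ → ℤ) (P : ℤ → Prop) {N : ℕ} (θ' : Fin (N + 1) → ℤ)
    (τ : Fin (N + 1) → Equiv.Perm (Fin m)) (hθ : StrictMono θ') (hinj : Function.Injective τ)
    (hτP : ∀ k b, P ((τ k b : ℤ) - b))
    (huniq : ∀ k (σ : Equiv.Perm (Fin m)), σ ≠ τ k → (∀ b, P ((σ b : ℤ) - b)) →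
      ∑ b, (θ' k * ψ ((σ b : ℤ) - b) + α ((σ b : ℤ) - b)) <
        ∑ b, (θ' k * ψ ((τ k b : ℤ) - b) + α ((τ k b : ℤ) - b)))
    (a ℓ : ℕ) (h : a + ℓ ≤ m) (S : Finset (Fin (N + 1)))
    (hinvS : ∀ k ∈ S, ∀ b : Fin m, a ≤ (b : ℕ) → (b : ℕ) < a + ℓ →
      a ≤ ((τ k b : Fin m) : ℕ) ∧ ((τ k b : Fin m) : ℕ) < a + ℓ)
    (houtS : ∀ k ∈ S, ∀ k' ∈ S, ∀ x : Fin m, ¬ (a ≤ (x : ℕ) ∧ (x : ℕ) < a + ℓ) → τ k x = τ k' x)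
    (Φ : ℕ)
    (hΦ : ∀ (N' : ℕ) (θ'' : Fin (N' + 1) → ℤ) (τ'' : Fin (N' + 1) → Equiv.Perm (Fin ℓ)),
      StrictMono θ'' → Function.Injective τ'' → (∀ k j, P ((τ'' k j : ℤ) - (j : ℤ))) →
      (∀ k (σ' : Equiv.Perm (Fin ℓ)), σ' ≠ τ'' k → (∀ j, P ((σ' j : ℤ) - (j : ℤ))) →
        ∑ j, (θ'' k * ψ ((σ' j : ℤ) - (j : ℤ)) + α ((σ' j : ℤ) - (j : ℤ))) <
          ∑ j, (θ'' k * ψ ((τ'' k j : ℤ) - (j : ℤ)) + α ((τ'' k j : ℤ) - (j : ℤ)))) →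
      N' + 1 ≤ Φ) :
    S.card ≤ Φ := by
  rcases Nat.eq_zero_or_pos S.card with h0 | hpos
  · rw [h0]; exact Nat.zero_le _
  obtain ⟨N', hN'⟩ : ∃ N', S.card = N' + 1 := ⟨S.card - 1, by omega⟩
  have key : ∀ k, k ∈ S → ∃ τw : Equiv.Perm (Fin ℓ),
      (∀ (j : Fin ℓ) (b : Fin m), (b : ℕ) = a + j → ((τw j : Fin ℓ) : ℕ) + a = ((τ k b : Fin m) : ℕ)) ∧
      (∀ j, P ((τw j : ℤ) - j)) ∧
      ∀ σ' : Equiv.Perm (Fin ℓ), σ' ≠ τw → (∀ j, P ((σ' j : ℤ) - j)) →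
        ∑ j, (θ' k * ψ ((σ' j : ℤ) - j) + α ((σ' j : ℤ) - j)) <
          ∑ j, (θ' k * ψ ((τw j : ℤ) - j) + α ((τw j : ℤ) - j)) :=
    fun k hk => toeplitz_opt_window ψ α P (θ' k) (τ k) a ℓ h (hinvS k hk) (hτP k) (huniq k)
  choose τw hτw hPw hUw using key
  let ι := S.orderEmbOfFin hN'
  have hιmem : ∀ i, ι i ∈ S := fun i => S.orderEmbOfFin_mem hN' i
  let θ'' : Fin (N' + 1) → ℤ := fun i => θ' (ι i)
  let τ'' : Fin (N' + 1) → Equiv.Perm (Fin ℓ) := fun i => τw (ι i) (hιmem i)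
  have hθ'' : StrictMono θ'' := fun i i' hii => hθ (ι.strictMono hii)
  have hτ'' : Function.Injective τ'' := by
    intro i i' hii
    have hk : τ (ι i) = τ (ι i') := by
      apply Equiv.ext
      intro x
      by_cases hx : a ≤ (x : ℕ) ∧ (x : ℕ) < a + ℓ
      · apply Fin.ext
        have h1 := hτw (ι i) (hιmem i) ⟨(x : ℕ) - a, by omega⟩ x (by simp; omega)
        have h2 := hτw (ι i') (hιmem i') ⟨(x : ℕ) - a, by omega⟩ x (by simp; omega)
        have h3 : τ'' i = τ'' i' := hii
        simp only [τ''] at h3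
        rw [h3] at h1
        omega
      · exact houtS (ι i) (hιmem i) (ι i') (hιmem i') x hx
    exact ι.injective (hinj hk)
  rw [hN']
  exact hΦ N' θ'' τ'' hθ'' hτ'' (fun i j => hPw (ι i) (hιmem i) j) (fun i σ' hσ' hσ'P => hUw (ι i) (hιmem i) σ' hσ' hσ'P)

/-- **The transposition frame.**  Along a chain in size `n + 2`, the indices whose permutation contains the transposition
`(0, n+1)` (`τ k 0 = last`, `τ k last = 0`) number at most `Φ`, for any `Φ` bounding the chains of the same instance at the
middle size `n` (`toeplitz_window_chain_le` with the window `[1, n+1)`).  This is the «(m−1, −(m−1)) frame» of the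
extremal Conjecture-T chains in kernel form: its members are the chain of the size-`(m−2)` instance, conjugated.
[folklore] -/
theorem toeplitz_transpositionFrame_chain_le {n : ℕ} (ψ α : ℤ → ℤ) (P : ℤ → Prop) {N : ℕ} (θ' : Fin (N + 1) → ℤ)
    (τ : Fin (N + 1) → Equiv.Perm (Fin (n + 2))) (hθ : StrictMono θ') (hinj : Function.Injective τ)
    (hτP : ∀ k b, P ((τ k b : ℤ) - b))
    (huniq : ∀ k (σ : Equiv.Perm (Fin (n + 2))), σ ≠ τ k → (∀ b, P ((σ b : ℤ) - b)) →
      ∑ b, (θ' k * ψ ((σ b : ℤ) - b) + α ((σ b : ℤ) - b)) <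
        ∑ b, (θ' k * ψ ((τ k b : ℤ) - b) + α ((τ k b : ℤ) - b)))
    (S : Finset (Fin (N + 1)))
    (hS : ∀ k ∈ S, τ k 0 = Fin.last (n + 1) ∧ τ k (Fin.last (n + 1)) = 0)
    (Φ : ℕ)
    (hΦ : ∀ (N' : ℕ) (θ'' : Fin (N' + 1) → ℤ) (τ'' : Fin (N' + 1) → Equiv.Perm (Fin n)),
      StrictMono θ'' → Function.Injective τ'' → (∀ k j, P ((τ'' k j : ℤ) - (j : ℤ))) →
      (∀ k (σ' : Equiv.Perm (Fin n)), σ' ≠ τ'' k → (∀ j, P ((σ' j : ℤ) - (j : ℤ))) →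
        ∑ j, (θ'' k * ψ ((σ' j : ℤ) - (j : ℤ)) + α ((σ' j : ℤ) - (j : ℤ))) <
          ∑ j, (θ'' k * ψ ((τ'' k j : ℤ) - (j : ℤ)) + α ((τ'' k j : ℤ) - (j : ℤ)))) →
      N' + 1 ≤ Φ) :
    S.card ≤ Φ := by
  refine toeplitz_window_chain_le ψ α P θ' τ hθ hinj hτP huniq 1 n (by omega) S ?_ ?_ Φ hΦ
  · intro k hk b hb1 hb2
    obtain ⟨h0, hl⟩ := hS k hk
    have hb0 : b ≠ 0 := fun e => by rw [e] at hb1; simp at hb1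
    have hbl : b ≠ Fin.last (n + 1) := fun e => by rw [e, Fin.val_last] at hb2; omega
    have h1 : τ k b ≠ Fin.last (n + 1) := fun e => hb0 ((τ k).injective (e.trans h0.symm))
    have h2 : τ k b ≠ 0 := fun e => hbl ((τ k).injective (e.trans hl.symm))
    have h3 : ((τ k b : Fin (n + 2)) : ℕ) ≠ n + 1 := fun e => h1 (Fin.ext (by rw [e, Fin.val_last]))
    have h4 : ((τ k b : Fin (n + 2)) : ℕ) ≠ 0 := fun e => h2 (Fin.ext e)
    have h5 := (τ k b).isLt
    constructor <;> omega
  · intro k hk k' hk' x hx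
    have hx' : x = 0 ∨ x = Fin.last (n + 1) := by
      have := x.isLt
      rcases Nat.eq_zero_or_pos (x : ℕ) with h0 | hpos
      · left; exact Fin.ext h0
      · right; apply Fin.ext; rw [Fin.val_last]; omega
    obtain ⟨h0, hl⟩ := hS k hk
    obtain ⟨h0', hl'⟩ := hS k' hk'
    rcases hx' with rfl | rfl
    · rw [h0, h0']
    · rw [hl, hl']

end Window

end Summit.ValiantsHypothesis.ValiantsHypothesis.Theorems.KPlusLogSqLaw
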